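import Literature.NumberTheory.Automorphic.TateGaussSums
import Literature.NumberTheory.Automorphic.TateSelfDualHaar
import HarnessLib

/-!
# Weil's Gauss integrals `g(f, M) = ∫_M ψ(a x²) dx` over a non-archimedean local field: stabilisation

Topic `NumberTheory/Weil1964`; namespace `Literature.NumberTheory.Weil1964`. KERNEL mathematics only
(definitions with bodies + theorems; no named fact, no `axiom`, no `sorry`).

Let `F` be a non-archimedean local field, `μ` an additive Haar measure on `F`, `ψ` a non-trivial additive
character of conductor exponent `d` (`AddChar.HasConductorExp`: trivial on `𝔭^d`, not on `𝔭^{d-1}`),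
`a ∈ F` with `‖a‖_F = q^{-v}` and `‖2‖_F = q^{-v₂}` (so `2 ≠ 0`: in characteristic `2` the form `a x²` is
degenerate in Weil's sense, [Weil1964, Chap. II n° 23 p. 172]). Weil ([Weil1964], Chap. II n° 27,
pp. 174–175) attaches to the quadratic form `f(x) = a x²` and a lattice `M = 𝔭^n` the integral

  `g(f, M) = ∫_M ψ(f(x)) dx`   (`gaussBall ψ μ a n`),

shows that `g(f, M)` is INDEPENDENT of `M` as soon as `M ⊇ L'` ("donc dès que `M` est assez grand"), calls the
stable value `g(f)` (`weilGauss ψ μ a`), and defines the Weil index `γ(f) = g(f)/|g(f)|` (n° 27, last display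
p. 175; the index itself is the sequel file `LocalWeilIndex.lean`). This file proves the stabilisation with
the explicit threshold `2 n ≤ d - v - 2 v₂` (for `ψ` of order `0`, `a` a unit and `q` odd: every `n ≤ 0`):

* §0 `psiSq ψ a x = ψ(a x²)` (the "caractère du second degré" `χ ∘ f`, n° 24 p. 172) and the continuity of a
  character of finite conductor exponent;
* §1 `gaussBall`; the COSET FORMULA `∫_{x₀ + 𝔭^ℓ} ψ(a x²) dx = ψ(a x₀²) · μ(𝔭^ℓ) · [2 a x₀ ∈ 𝔭^{d-ℓ}]` for
  `a 𝔭^{2ℓ} ⊆ 𝔭^d` (Weil's (27), p. 174: `Φ_L * (χ∘f) = m(L) φ_{L'} · (χ∘f)`);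
* §2 the SHELL INTEGRALS VANISH below the threshold: `∫_{𝔭^j ∖ 𝔭^{j+1}} ψ(a x²) dx = 0` for
  `2j + 2 ≤ d - v - 2v₂` (each coset of `𝔭^ℓ`, `ℓ = d - v - v₂ - 1 - j`, inside the shell contributes `0`);
* §3 STABILISATION `gaussBall ψ μ a n = gaussBall ψ μ a n'` for `n ≤ n'`, `2n' ≤ d - v - 2v₂` (n° 27), the stable
  value `weilGauss ψ μ a := lim_{n → -∞} gaussBall ψ μ a n` with `weilGauss = gaussBall n` on the stable range and
  `∀ᶠ n in atBot, gaussBall ψ μ a n = weilGauss ψ μ a`;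
* §4 first evaluations: `g(-f) = conj g(f)` (n° 25 p. 173: `χ∘(-f)` is the complex conjugate of `χ∘f`), the dilation
  rule `g(a b², 𝔭^n) = ‖b‖⁻¹ g(a, 𝔭^{n + ord b})` (n° 25: equivalent forms), and the UNRAMIFIED VALUE
  `g(f) = μ(𝒪)` for `d = 0`, `‖a‖ = ‖2‖ = 1` (n° 27 with `M' = L`: the Gauss sum has the single term `x = 0`).

Only the one-variable (diagonal) case is treated: by [Weil1964, n° 25 Prop. 3] (`γ(f₁ ⊕ f₂) = γ(f₁)γ(f₂)`) this
is what diagonal hermitian forms — the instances of the tree's `UnitaryDualPair.cmSplittingDatum` — require.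
-- TODO(general form): `g(f, M)` for a non-degenerate quadratic form on `Fⁿ` and an arbitrary lattice `M`.

## References

* [Weil1964] A. Weil, *Sur certains groupes d'opérateurs unitaires*, Acta Math. 111 (1964) 143–211: Chap. I n° 14
  Thm 2 + Cor. 2 (pp. 161–162); Chap. II n° 24–25 (pp. 172–173), n° 27 (pp. 174–175).
* [Tate1950] J. Tate, *Fourier analysis in number fields and Hecke's zeta-functions*, §2.2–2.5 (the ball/character
  integrals used, tree files `TateLocalZetaShells`, `TateGaussSums`, `TateSelfDualHaar`).
-/

set_option autoImplicit false

noncomputable section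

open MeasureTheory ValuativeRel Filter Topology Set
open scoped NNReal ENNReal Pointwise
open Literature.NumberTheory.GaloisRepresentations.IsNonarchimedeanLocalField
open Literature.NumberTheory.Automorphic

namespace Literature.NumberTheory.Weil1964

variable {F : Type*} [Field F]

/-! ## §0 The second-degree character `x ↦ ψ(a x²)`; the Gauss integrals; continuity of `ψ` -/

section Character

variable (ψ : AddChar F Circle)

/-- The **second-degree character** `x ↦ ψ(a x²)` of `F` attached to the quadratic form `f(x) = a x²`
(Weil's `χ ∘ f`), as a complex-valued function. [cite: Weil1964, Chap. II n° 24, p. 172] -/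
def psiSq (a : F) (x : F) : ℂ := ψ (a * x ^ 2)

/-- unfolding. [cite: Weil1964, Chap. II n° 24, p. 172] -/
theorem psiSq_apply (a x : F) : psiSq ψ a x = ψ (a * x ^ 2) := rfl

/-- `|ψ(a x²)| = 1`: characters of the second degree take values in the unit circle `T`.
[cite: Weil1964, Chap. I n° 2, p. 146] -/
theorem norm_psiSq (a x : F) : ‖psiSq ψ a x‖ = 1 := Circle.norm_coe _

/-- `ψ(a · 0²) = 1`. [cite: Weil1964, Chap. I n° 2, p. 146] -/
theorem psiSq_zero (a : F) : psiSq ψ a 0 = 1 := by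
  simp [psiSq]

/-- **the second-degree law** `ψ(a(x+y)²) = ψ(a x²) ψ(a y²) ψ(y · 2 a x)`: `χ ∘ f` is a character of the second
degree with associated bicharacter `ψ(2 a x y)`. [cite: Weil1964, Chap. I n° 2, p. 146] -/
theorem psiSq_add (a x y : F) :
    psiSq ψ a (x + y) = psiSq ψ a x * psiSq ψ a y * ψ (y * (2 * a * x)) := by
  simp only [psiSq]
  rw [show a * (x + y) ^ 2 = a * x ^ 2 + a * y ^ 2 + y * (2 * a * x) by ring, AddChar.map_add_eq_mul,
    AddChar.map_add_eq_mul, Circle.coe_mul, Circle.coe_mul]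

/-- `χ ∘ (-f)` is the complex conjugate of `χ ∘ f`. [cite: Weil1964, Chap. II n° 25, p. 173] -/
theorem psiSq_neg (a x : F) : psiSq ψ (-a) x = (starRingEnd ℂ) (psiSq ψ a x) := by
  simp only [psiSq]
  rw [neg_mul, AddChar.map_neg_eq_inv, Circle.coe_inv_eq_conj]

/-- equivalent forms: `ψ((a b²) x²) = ψ(a (b x)²)`. [cite: Weil1964, Chap. II n° 25, p. 173] -/
theorem psiSq_mul_sq (a b x : F) : psiSq ψ (a * b ^ 2) x = psiSq ψ a (b * x) := by
  simp only [psiSq, mul_pow, mul_assoc]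

/-- **Weil's Gauss integral** `g(f, M) = ∫_M χ(f(x)) dx` for the quadratic form `f(x) = a x²` and the lattice
`M = 𝔭^n` of the non-archimedean local field `F` (additive Haar measure `μ`).
[cite: Weil1964, Chap. II n° 27, p. 175] -/
def gaussBall [ValuativeRel F] [TopologicalSpace F] [IsNonarchimedeanLocalField F] [MeasurableSpace F]
    (μ : Measure F) (a : F) (n : ℤ) : ℂ :=
  ∫ x in primePowBall F n, psiSq ψ a x ∂μ

/-- **Weil's stable value** `g(f) = lim_{M} g(f, M)` of the Gauss integrals of `f(x) = a x²` over the lattices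
`M = 𝔭^n`, `n → -∞` (a genuine limit: the sequence is eventually constant, `gaussBall_eq_of_le`).
[cite: Weil1964, Chap. II n° 27, p. 175] -/
def weilGauss [ValuativeRel F] [TopologicalSpace F] [IsNonarchimedeanLocalField F] [MeasurableSpace F]
    (μ : Measure F) (a : F) : ℂ :=
  limUnder atBot (gaussBall ψ μ a)

end Character

section LocalField

variable [ValuativeRel F] [TopologicalSpace F] [IsNonarchimedeanLocalField F] {ψ : AddChar F Circle}

/-- A character of finite conductor exponent (BH: "level") is continuous: it is constant on every coset of
the open subgroup `𝔭^d`. [cite: BushnellHenniart2006, §1.7] -/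
theorem continuous_of_hasConductorExp {d : ℤ} (hd : ψ.HasConductorExp d) : Continuous ψ := by
  refine continuous_iff_continuousAt.2 fun x => ?_
  have hx : x +ᵥ primePowBall F d ∈ 𝓝 x :=
    (isOpen_vadd_primePowBall d x).mem_nhds (self_mem_vadd_primePowBall d x)
  refine (continuousAt_const (y := ψ x)).congr_of_eventuallyEq ?_
  filter_upwards [hx] with y hy
  rw [mem_vadd_primePowBall_iff] at hy
  calc ψ y = ψ (x + (y - x)) := by rw [add_sub_cancel]
    _ = ψ x := by rw [AddChar.map_add_eq_mul, hd.1 _ hy, mul_one]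

/-- `x ↦ ψ(a x²)` is continuous for continuous `ψ` (Weil's second-degree characters are continuous maps
`G → T` by definition). [cite: Weil1964, Chap. I n° 2, p. 146] -/
theorem continuous_psiSq (hψ : Continuous ψ) (a : F) : Continuous (psiSq ψ a) :=
  continuous_subtype_val.comp (hψ.comp (continuous_const.mul (continuous_id.pow 2)))

/-- the data `(d, v, v₂)` exist for `ψ` continuous non-trivial, `a ≠ 0`, `2 ≠ 0`: a non-trivial character
has a level, and `‖x‖_F = q^{-v(x)}` for `x ≠ 0`. [cite: BushnellHenniart2006, §1.1 and §1.7] -/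
theorem exists_exponents (hψ : ψ.IsContinuousNontrivial) {a : F} (ha : a ≠ 0) (htwo : (2 : F) ≠ 0) :
    ∃ d v v₂ : ℤ, ψ.HasConductorExp d ∧ normAbs F a = (residueFieldCard F : ℝ≥0)⁻¹ ^ v ∧
      normAbs F (2 : F) = (residueFieldCard F : ℝ≥0)⁻¹ ^ v₂ := by
  obtain ⟨d, hd⟩ := hψ.exists_hasConductorExp
  obtain ⟨v, hv⟩ := exists_normAbs_eq_inv_zpow ha
  obtain ⟨v₂, hv₂⟩ := exists_normAbs_eq_inv_zpow htwo
  exact ⟨d, v, v₂, hd, hv, hv₂⟩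

/-- `‖2‖_F ≤ 1` (`2 = 1 + 1 ∈ 𝒪`, ultrametric inequality). [cite: BushnellHenniart2006, §1.1] -/
theorem normAbs_two_le_one : normAbs F (2 : F) ≤ 1 := by
  have h := normAbs_add_le_max (F := F) 1 1
  rwa [map_one, max_self, one_add_one_eq_two] at h

/-- if `‖2‖_F = q^{-v₂}` then `0 ≤ v₂` (`2 ∈ 𝒪`). [cite: BushnellHenniart2006, §1.1] -/
theorem nonneg_of_normAbs_two_eq {v₂ : ℤ} (h2 : normAbs F (2 : F) = (residueFieldCard F : ℝ≥0)⁻¹ ^ v₂) :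
    0 ≤ v₂ := by
  have h : (residueFieldCard F : ℝ≥0)⁻¹ ^ v₂ ≤ (residueFieldCard F : ℝ≥0)⁻¹ ^ (0 : ℤ) := by
    rw [zpow_zero, ← h2]
    exact normAbs_two_le_one
  exact inv_residueFieldCard_zpow_le_iff.1 h

end LocalField

variable [ValuativeRel F] [TopologicalSpace F] [IsNonarchimedeanLocalField F]

/-! ## §1 The Gauss integrals `g(f, 𝔭^n)` and the coset formula -/

section Gauss

variable [MeasurableSpace F] [BorelSpace F] (μ : Measure F) [μ.IsAddHaarMeasure] {ψ : AddChar F Circle}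

omit [μ.IsAddHaarMeasure] in
/-- `x ↦ ψ(a x²)` is integrable on every set of finite measure (helper). [folklore] -/
private theorem integrableOn_psiSq (hψ : Continuous ψ) (a : F) {s : Set F} (hs : μ s ≠ ∞) :
    IntegrableOn (psiSq ψ a) s μ :=
  Measure.integrableOn_of_bounded (M := 1) hs (continuous_psiSq hψ a).aestronglyMeasurable
    (Eventually.of_forall fun x => (norm_psiSq ψ a x).le)

omit [μ.IsAddHaarMeasure] in
/-- `1_s · c · ψ(a x²)` is integrable for `s` measurable of finite measure (helper). [folklore] -/
private theorem integrable_indicator_mul_psiSq (hψ : Continuous ψ) (a : F) {s : Set F} (hs : MeasurableSet s)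
    (hs' : μ s ≠ ∞) (c : ℂ) :
    Integrable (fun x => s.indicator (fun _ => c) x * psiSq ψ a x) μ := by
  have e : (fun x => s.indicator (fun _ => c) x * psiSq ψ a x) = s.indicator (fun x => c * psiSq ψ a x) := by
    funext x
    by_cases hx : x ∈ s
    · rw [Set.indicator_of_mem hx, Set.indicator_of_mem hx]
    · rw [Set.indicator_of_notMem hx, Set.indicator_of_notMem hx, zero_mul]
  rw [e]
  have hf : IntegrableOn (fun x => c * psiSq ψ a x) s μ := (integrableOn_psiSq μ hψ a hs').const_mul c
  exact hf.integrable_indicator hs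

omit [BorelSpace F] [μ.IsAddHaarMeasure] in
/-- unfolding. [cite: Weil1964, Chap. II n° 27, p. 175] -/
theorem gaussBall_def (a : F) (n : ℤ) : gaussBall ψ μ a n = ∫ x in primePowBall F n, psiSq ψ a x ∂μ := rfl

open scoped Classical in
/-- **The coset formula** (Weil's (27): `Φ_L * (χ∘f) = m(L) φ_{L'} (χ∘f)` for a lattice `L = 𝔭^ℓ` on which
`χ ∘ f = 1`): if `a y² ∈ 𝔭^d` for all `y ∈ 𝔭^ℓ`, then
`∫_{x₀ + 𝔭^ℓ} ψ(a x²) dx = ψ(a x₀²) · μ(𝔭^ℓ)` when `2 a x₀ ∈ 𝔭^{d-ℓ}`, and `= 0` otherwise.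
[cite: Weil1964, Chap. II n° 27, (27) p. 174] -/
theorem setIntegral_vadd_primePowBall_psiSq {d : ℤ} (hd : ψ.HasConductorExp d) (a x₀ : F) {ℓ : ℤ}
    (hℓ : ∀ y ∈ primePowBall F ℓ, a * y ^ 2 ∈ primePowBall F d) :
    ∫ x in x₀ +ᵥ primePowBall F ℓ, psiSq ψ a x ∂μ =
      psiSq ψ a x₀ *
        (if 2 * a * x₀ ∈ primePowBall F (d - ℓ) then (μ.real (primePowBall F ℓ) : ℂ) else 0) := by
  rw [← setIntegral_primePowBall_addChar_mul μ hd ℓ (2 * a * x₀),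
    ← integral_indicator (measurableSet_vadd_primePowBall ℓ x₀),
    ← integral_indicator (measurableSet_primePowBall ℓ), ← integral_const_mul,
    ← integral_add_left_eq_self _ x₀]
  refine integral_congr_ae (Eventually.of_forall fun y => ?_)
  simp only
  by_cases hy : y ∈ primePowBall F ℓ
  · have hy' : x₀ + y ∈ x₀ +ᵥ primePowBall F ℓ := Set.mem_vadd_set.2 ⟨y, hy, rfl⟩
    have h1 : psiSq ψ a y = 1 := by
      rw [psiSq, hd.1 _ (hℓ y hy), Circle.coe_one]
    rw [Set.indicator_of_mem hy', Set.indicator_of_mem hy, psiSq_add, h1, mul_one]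
  · have hy' : x₀ + y ∉ x₀ +ᵥ primePowBall F ℓ := fun h => by
      obtain ⟨y', hy'', h⟩ := Set.mem_vadd_set.1 h
      rw [vadd_eq_add, add_right_inj] at h
      exact hy (h ▸ hy'')
    rw [Set.indicator_of_notMem hy', Set.indicator_of_notMem hy, mul_zero]

end Gauss

/-! ## §2 The shell integrals vanish below the threshold -/

section Shell

variable {ψ : AddChar F Circle}

/-- A coset `x₀ + 𝔭^ℓ` with `ℓ ≥ j + 1` that meets the shell `S_j = 𝔭^j ∖ 𝔭^{j+1}` lies inside it (helper).
[folklore] -/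
private theorem vadd_primePowBall_subset_shell {j ℓ : ℤ} (hℓ : j + 1 ≤ ℓ) {x₀ u : F}
    (hu : u ∈ x₀ +ᵥ primePowBall F ℓ) (hus : u ∈ primePowBall F j \ primePowBall F (j + 1)) :
    x₀ +ᵥ primePowBall F ℓ ⊆ primePowBall F j \ primePowBall F (j + 1) := by
  intro w hw
  rw [mem_vadd_primePowBall_iff] at hu hw
  have h1 : w - u ∈ primePowBall F (j + 1) := by
    have e : w - u = (w - x₀) + -(u - x₀) := by ring
    rw [e]
    exact primePowBall_antitone hℓ (add_mem_primePowBall hw (neg_mem_primePowBall hu))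
  have h2 := (TateDirect.add_mem_shell_iff h1 u).2 hus
  rwa [sub_add_cancel] at h2

/-- The indicator of a shell is Schwartz–Bruhat (`1_{S_j} = 1_{𝔭^j} - 1_{𝔭^{j+1}}`; helper). [folklore] -/
private theorem indicator_shell_mem_schwartzBruhat (j : ℤ) :
    (primePowBall F j \ primePowBall F (j + 1)).indicator (fun _ => (1 : ℂ)) ∈ SchwartzBruhat F := by
  have e : (primePowBall F j \ primePowBall F (j + 1)).indicator (fun _ => (1 : ℂ)) =
      (primePowBall F j).indicator (fun _ => (1 : ℂ)) - (primePowBall F (j + 1)).indicator (fun _ => (1 : ℂ)) := by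
    funext x
    simp only [Pi.sub_apply]
    by_cases h1 : x ∈ primePowBall F (j + 1)
    · have h0 : x ∈ primePowBall F j := primePowBall_antitone (by omega) h1
      have hxS : x ∉ primePowBall F j \ primePowBall F (j + 1) := fun h => h.2 h1
      rw [Set.indicator_of_notMem hxS, Set.indicator_of_mem h0, Set.indicator_of_mem h1, sub_self]
    · by_cases h0 : x ∈ primePowBall F j
      · have hxS : x ∈ primePowBall F j \ primePowBall F (j + 1) := ⟨h0, h1⟩
        rw [Set.indicator_of_mem hxS, Set.indicator_of_mem h0, Set.indicator_of_notMem h1, sub_zero]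
      · have hxS : x ∉ primePowBall F j \ primePowBall F (j + 1) := fun h => h0 h.1
        rw [Set.indicator_of_notMem hxS, Set.indicator_of_notMem h0, Set.indicator_of_notMem h1, sub_zero]
  rw [e]
  exact Submodule.sub_mem _ (indicator_primePowBall_mem_schwartzBruhat j 1)
    (indicator_primePowBall_mem_schwartzBruhat (j + 1) 1)

variable [MeasurableSpace F] [BorelSpace F] (μ : Measure F) [μ.IsAddHaarMeasure]

open scoped Classical in
/-- **The shell integrals vanish**: for `ψ` of conductor exponent `d`, `‖a‖ = q^{-v}`, `‖2‖ = q^{-v₂}` and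
`2j + 2 ≤ d - v - 2v₂`, `∫_{𝔭^j ∖ 𝔭^{j+1}} ψ(a x²) dx = 0`. Proof: the shell is a finite disjoint union of cosets of
`𝔭^ℓ`, `ℓ = d - v - v₂ - 1 - j ≥ j + 1`, with `a 𝔭^{2ℓ} ⊆ 𝔭^d`, and on each the coset formula gives `0` because
`‖2 a x₀‖ = q^{-(v₂+v+j)} > q^{-(d-ℓ)}` — Weil's independence of `g(f, M)` from `M ⊇ L'`, one shell at a time.
[cite: Weil1964, Chap. II n° 27, pp. 174–175] -/
theorem setIntegral_shell_psiSq_eq_zero {d : ℤ} (hd : ψ.HasConductorExp d) {a : F} {v : ℤ}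
    (ha : normAbs F a = (residueFieldCard F : ℝ≥0)⁻¹ ^ v) {v₂ : ℤ}
    (h2 : normAbs F (2 : F) = (residueFieldCard F : ℝ≥0)⁻¹ ^ v₂) {j : ℤ} (hj : 2 * j + 2 ≤ d - v - 2 * v₂) :
    ∫ x in primePowBall F j \ primePowBall F (j + 1), psiSq ψ a x ∂μ = 0 := by
  have hv₂ : 0 ≤ v₂ := nonneg_of_normAbs_two_eq h2
  have hψ : Continuous ψ := continuous_of_hasConductorExp hd
  set ℓ : ℤ := d - v - v₂ - 1 - j with hℓdef
  set S : Set F := primePowBall F j \ primePowBall F (j + 1) with hSdef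
  have hℓ1 : j + 1 ≤ ℓ := by omega
  have hℓ2 : ∀ y ∈ primePowBall F ℓ, a * y ^ 2 ∈ primePowBall F d := by
    intro y hy
    have hav : a ∈ primePowBall F v := by rw [mem_primePowBall_iff, ha]
    have h3 := mul_mem_primePowBall (mul_mem_primePowBall hav hy) hy
    rw [show a * y * y = a * y ^ 2 by ring] at h3
    exact primePowBall_antitone (by omega) h3
  have hℓ3 : ∀ x₀ ∈ S, 2 * a * x₀ ∉ primePowBall F (d - ℓ) := by
    intro x₀ hx₀ hmem
    rw [hSdef, LocalFieldHaar.mem_shell_iff] at hx₀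
    rw [mem_primePowBall_iff, map_mul, map_mul, h2, ha, hx₀, ← zpow_add₀ inv_residueFieldCard_pos.ne',
      ← zpow_add₀ inv_residueFieldCard_pos.ne', inv_residueFieldCard_zpow_le_iff] at hmem
    omega
  -- decompose the shell indicator along cosets of `𝔭^ℓ`
  obtain ⟨C, hC, hsum⟩ := exists_finset_eq_sum_indicator (indicator_shell_mem_schwartzBruhat (F := F) j) ℓ
  have hSm : MeasurableSet S := LocalFieldHaar.measurableSet_shell j
  have hSfin : μ S ≠ ∞ :=
    ((measure_mono Set.sdiff_subset).trans_lt (measure_primePowBall_lt_top μ j)).ne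
  -- each coset term vanishes
  have hterm : ∀ B ∈ C, ∫ x, B.indicator (S.indicator fun _ => (1 : ℂ)) x * psiSq ψ a x ∂μ = 0 := by
    intro B hB
    obtain ⟨x₀, rfl⟩ := hC B hB
    by_cases hne : ((x₀ +ᵥ primePowBall F ℓ) ∩ S).Nonempty
    · obtain ⟨u, huB, huS⟩ := hne
      have hsub : x₀ +ᵥ primePowBall F ℓ ⊆ S := vadd_primePowBall_subset_shell hℓ1 huB huS
      have e1 : (fun x => (x₀ +ᵥ primePowBall F ℓ).indicator (S.indicator fun _ => (1 : ℂ)) x * psiSq ψ a x) =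
          (x₀ +ᵥ primePowBall F ℓ).indicator (psiSq ψ a) := by
        funext x
        rw [Set.indicator_indicator, Set.inter_eq_left.2 hsub]
        by_cases hx : x ∈ x₀ +ᵥ primePowBall F ℓ
        · rw [Set.indicator_of_mem hx, Set.indicator_of_mem hx, one_mul]
        · rw [Set.indicator_of_notMem hx, Set.indicator_of_notMem hx, zero_mul]
      rw [e1, integral_indicator (measurableSet_vadd_primePowBall ℓ x₀),
        setIntegral_vadd_primePowBall_psiSq μ hd a x₀ hℓ2,
        if_neg (hℓ3 x₀ (hsub (self_mem_vadd_primePowBall ℓ x₀))), mul_zero]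
    · have h0 : (x₀ +ᵥ primePowBall F ℓ) ∩ S = ∅ := Set.not_nonempty_iff_eq_empty.1 hne
      have e1 : (fun x => (x₀ +ᵥ primePowBall F ℓ).indicator (S.indicator fun _ => (1 : ℂ)) x * psiSq ψ a x) =
          fun _ => 0 := by
        funext x
        rw [Set.indicator_indicator, h0, Set.indicator_empty]
        exact zero_mul _
      rw [e1, integral_zero]
  -- integrability of each term
  have hint : ∀ B ∈ C, Integrable (fun x => B.indicator (S.indicator fun _ => (1 : ℂ)) x * psiSq ψ a x) μ := by
    intro B hB
    obtain ⟨x₀, rfl⟩ := hC B hB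
    have e1 : (fun x => (x₀ +ᵥ primePowBall F ℓ).indicator (S.indicator fun _ => (1 : ℂ)) x * psiSq ψ a x) =
        fun x => ((x₀ +ᵥ primePowBall F ℓ) ∩ S).indicator (fun _ => (1 : ℂ)) x * psiSq ψ a x := by
      funext x
      rw [Set.indicator_indicator]
    rw [e1]
    exact integrable_indicator_mul_psiSq μ hψ a ((measurableSet_vadd_primePowBall ℓ x₀).inter hSm)
      ((measure_mono Set.inter_subset_right).trans_lt hSfin.lt_top).ne 1
  calc ∫ x in S, psiSq ψ a x ∂μ = ∫ x, S.indicator (fun _ => (1 : ℂ)) x * psiSq ψ a x ∂μ := by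
        rw [← integral_indicator hSm]
        refine integral_congr_ae (Eventually.of_forall fun x => ?_)
        simp only
        by_cases hx : x ∈ S
        · rw [Set.indicator_of_mem hx, Set.indicator_of_mem hx, one_mul]
        · rw [Set.indicator_of_notMem hx, Set.indicator_of_notMem hx, zero_mul]
    _ = ∫ x, ∑ B ∈ C, B.indicator (S.indicator fun _ => (1 : ℂ)) x * psiSq ψ a x ∂μ := by
        refine integral_congr_ae (Eventually.of_forall fun x => ?_)
        simp only
        rw [hsum x, Finset.sum_mul]
    _ = ∑ B ∈ C, ∫ x, B.indicator (S.indicator fun _ => (1 : ℂ)) x * psiSq ψ a x ∂μ :=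
        integral_finsetSum C hint
    _ = 0 := Finset.sum_eq_zero hterm

end Shell

/-! ## §3 Stabilisation and the stable value `g(f)` -/

section Stable

variable [MeasurableSpace F] [BorelSpace F] (μ : Measure F) [μ.IsAddHaarMeasure] {ψ : AddChar F Circle}

/-- `g(f, 𝔭^n) = g(f, 𝔭^{n+1}) + ∫_{𝔭^n ∖ 𝔭^{n+1}} ψ(a x²) dx` (the lattice `𝔭^n` split along the next one, as in
Weil's sum over `M'/L`). [cite: Weil1964, Chap. II n° 27, p. 175] -/
theorem gaussBall_eq_succ_add (hψ : Continuous ψ) (a : F) (n : ℤ) :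
    gaussBall ψ μ a n = gaussBall ψ μ a (n + 1) +
      ∫ x in primePowBall F n \ primePowBall F (n + 1), psiSq ψ a x ∂μ := by
  unfold gaussBall
  rw [← setIntegral_union Set.disjoint_sdiff_right (LocalFieldHaar.measurableSet_shell n)
      (integrableOn_psiSq μ hψ a (measure_primePowBall_lt_top μ _).ne)
      (integrableOn_psiSq μ hψ a ((measure_mono Set.sdiff_subset).trans_lt (measure_primePowBall_lt_top μ n)).ne),
    Set.union_sdiff_cancel (primePowBall_antitone (by omega))]

/-- **Stabilisation** (Weil: `g(f, M)` is independent of `M` "dès que `M` est assez grand"): for `ψ` of conductor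
exponent `d`, `‖a‖ = q^{-v}`, `‖2‖ = q^{-v₂}`, and `n ≤ n'` with `2n' ≤ d - v - 2v₂`,
`g(f, 𝔭^n) = g(f, 𝔭^{n'})`. [cite: Weil1964, Chap. II n° 27, p. 175] -/
theorem gaussBall_eq_of_le {d : ℤ} (hd : ψ.HasConductorExp d) {a : F} {v : ℤ}
    (ha : normAbs F a = (residueFieldCard F : ℝ≥0)⁻¹ ^ v) {v₂ : ℤ}
    (h2 : normAbs F (2 : F) = (residueFieldCard F : ℝ≥0)⁻¹ ^ v₂) {n n' : ℤ} (hnn' : n ≤ n')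
    (hn' : 2 * n' ≤ d - v - 2 * v₂) : gaussBall ψ μ a n = gaussBall ψ μ a n' := by
  obtain ⟨k, rfl⟩ : ∃ k : ℕ, n = n' - k := ⟨(n' - n).toNat, by omega⟩
  clear hnn'
  induction k with
  | zero => simp
  | succ k ih =>
    have e : n' - ((k + 1 : ℕ) : ℤ) + 1 = n' - (k : ℕ) := by push_cast; ring
    rw [gaussBall_eq_succ_add μ (continuous_of_hasConductorExp hd) a (n' - ((k + 1 : ℕ) : ℤ)),
      setIntegral_shell_psiSq_eq_zero μ hd ha h2 (j := n' - ((k + 1 : ℕ) : ℤ)) (by push_cast; omega),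
      add_zero, e, ih]

/-- the Gauss integrals converge to `g(f, 𝔭^{n₀})` for any `n₀` in the stable range. [cite: Weil1964, Chap. II n° 27, p. 175] -/
theorem tendsto_gaussBall {d : ℤ} (hd : ψ.HasConductorExp d) {a : F} {v : ℤ}
    (ha : normAbs F a = (residueFieldCard F : ℝ≥0)⁻¹ ^ v) {v₂ : ℤ}
    (h2 : normAbs F (2 : F) = (residueFieldCard F : ℝ≥0)⁻¹ ^ v₂) {n₀ : ℤ} (hn₀ : 2 * n₀ ≤ d - v - 2 * v₂) :
    Tendsto (gaussBall ψ μ a) atBot (𝓝 (gaussBall ψ μ a n₀)) := by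
  refine tendsto_const_nhds.congr' ?_
  filter_upwards [eventually_le_atBot n₀] with n hn
  exact (gaussBall_eq_of_le μ hd ha h2 hn hn₀).symm

/-- **`g(f) = g(f, 𝔭^{n₀})` on the stable range** `2n₀ ≤ d - v - 2v₂`. [cite: Weil1964, Chap. II n° 27, p. 175] -/
theorem weilGauss_eq_gaussBall {d : ℤ} (hd : ψ.HasConductorExp d) {a : F} {v : ℤ}
    (ha : normAbs F a = (residueFieldCard F : ℝ≥0)⁻¹ ^ v) {v₂ : ℤ}
    (h2 : normAbs F (2 : F) = (residueFieldCard F : ℝ≥0)⁻¹ ^ v₂) {n₀ : ℤ} (hn₀ : 2 * n₀ ≤ d - v - 2 * v₂) :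
    weilGauss ψ μ a = gaussBall ψ μ a n₀ :=
  (tendsto_gaussBall μ hd ha h2 hn₀).limUnder_eq

/-- **`g(f, M) = g(f)` for all `M` large enough** (Weil's formulation). [cite: Weil1964, Chap. II n° 27, p. 175] -/
theorem eventually_gaussBall_eq_weilGauss (hψ : ψ.IsContinuousNontrivial) {a : F} (ha : a ≠ 0)
    (htwo : (2 : F) ≠ 0) : ∀ᶠ n in atBot, gaussBall ψ μ a n = weilGauss ψ μ a := by
  obtain ⟨d, v, v₂, hd, hv, hv₂⟩ := exists_exponents hψ ha htwo
  obtain ⟨n₀, hn₀⟩ : ∃ n₀ : ℤ, 2 * n₀ ≤ d - v - 2 * v₂ := ⟨min (d - v - 2 * v₂) 0, by omega⟩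
  filter_upwards [eventually_le_atBot n₀] with n hn
  rw [weilGauss_eq_gaussBall μ hd hv hv₂ hn₀, gaussBall_eq_of_le μ hd hv hv₂ hn hn₀]

end Stable

/-! ## §4 First evaluations: conjugation, dilation, the unramified value -/

section Evaluations

variable [MeasurableSpace F] [BorelSpace F] (μ : Measure F) [μ.IsAddHaarMeasure] {ψ : AddChar F Circle}

omit [μ.IsAddHaarMeasure] in
/-- `g(-f, M) = conj g(f, M)`. [cite: Weil1964, Chap. II n° 25, p. 173] -/
theorem gaussBall_neg (a : F) (n : ℤ) : gaussBall ψ μ (-a) n = (starRingEnd ℂ) (gaussBall ψ μ a n) := by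
  unfold gaussBall
  rw [← integral_conj]
  exact setIntegral_congr_fun (measurableSet_primePowBall n) fun x _ => psiSq_neg ψ a x

/-- **`g(-f) = conj g(f)`** (so `γ(-f) = γ(f)⁻¹`). [cite: Weil1964, Chap. II n° 25, p. 173] -/
theorem weilGauss_neg (hψ : ψ.IsContinuousNontrivial) {a : F} (ha : a ≠ 0) (htwo : (2 : F) ≠ 0) :
    weilGauss ψ μ (-a) = (starRingEnd ℂ) (weilGauss ψ μ a) := by
  obtain ⟨d, v, v₂, hd, hv, hv₂⟩ := exists_exponents hψ ha htwo
  obtain ⟨n₀, hn₀⟩ : ∃ n₀ : ℤ, 2 * n₀ ≤ d - v - 2 * v₂ := ⟨min (d - v - 2 * v₂) 0, by omega⟩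
  have hv' : normAbs F (-a) = (residueFieldCard F : ℝ≥0)⁻¹ ^ v := by rw [normAbs_neg, hv]
  rw [weilGauss_eq_gaussBall μ hd hv' hv₂ hn₀, weilGauss_eq_gaussBall μ hd hv hv₂ hn₀, gaussBall_neg]

/-- **dilation** (equivalent forms `f ∘ b` and `f`): `g((a b²) x², 𝔭^n) = ‖b‖⁻¹ · g(a x², 𝔭^{n+k})` for
`‖b‖ = q^{-k}` (substitution `x ↦ b x`, `b 𝔭^n = 𝔭^{n+k}`, `d(bx) = ‖b‖ dx`).
[cite: Weil1964, Chap. II n° 25, p. 173] -/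
theorem gaussBall_mul_sq (a : F) {b : F} {k : ℤ} (hb : normAbs F b = (residueFieldCard F : ℝ≥0)⁻¹ ^ k)
    (n : ℤ) : gaussBall ψ μ (a * b ^ 2) n =
      (((normAbs F b)⁻¹ : ℝ≥0) : ℂ) * gaussBall ψ μ a (n + k) := by
  have hb0 : b ≠ 0 := by
    rintro rfl
    rw [map_zero] at hb
    exact (zpow_pos inv_residueFieldCard_pos k).ne hb
  unfold gaussBall
  rw [← integral_indicator (measurableSet_primePowBall n), ← integral_indicator (measurableSet_primePowBall (n + k))]
  have e : (fun x => (primePowBall F n).indicator (psiSq ψ (a * b ^ 2)) x) =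
      fun x => (primePowBall F (n + k)).indicator (psiSq ψ a) (b * x) := by
    funext x
    by_cases hx : x ∈ primePowBall F n
    · have hbx : b * x ∈ primePowBall F (n + k) := by
        rw [mul_mem_primePowBall_iff hb, add_sub_cancel_right]; exact hx
      rw [Set.indicator_of_mem hx, Set.indicator_of_mem hbx, psiSq_mul_sq]
    · have hbx : b * x ∉ primePowBall F (n + k) := fun h => hx (by
        rw [mul_mem_primePowBall_iff hb, add_sub_cancel_right] at h; exact h)
      rw [Set.indicator_of_notMem hx, Set.indicator_of_notMem hbx]
  rw [e, integral_comp_mul_left μ hb0, map_inv₀, Complex.real_smul, NNReal.coe_inv, Complex.ofReal_inv]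

omit [μ.IsAddHaarMeasure] in
/-- `g(f, 𝒪) = μ(𝒪)` when `ψ` has conductor exponent `0` and `‖a‖ ≤ 1` (then `ψ(a x²) = 1` on `𝒪`).
[cite: Weil1964, Chap. II n° 27, p. 175] -/
theorem gaussBall_zero_of_unramified (hd : ψ.HasConductorExp 0) {a : F} (ha : normAbs F a ≤ 1) :
    gaussBall ψ μ a 0 = μ.real (primePowBall F 0) := by
  unfold gaussBall
  have h : ∀ x ∈ primePowBall F 0, psiSq ψ a x = 1 := fun x hx => by
    have hav : a ∈ primePowBall F 0 := by rwa [mem_primePowBall_iff, zpow_zero]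
    have h3 := mul_mem_primePowBall (mul_mem_primePowBall hav hx) hx
    rw [show a * x * x = a * x ^ 2 by ring, show (0 : ℤ) + 0 + 0 = 0 by norm_num] at h3
    rw [psiSq, hd.1 _ h3, Circle.coe_one]
  rw [setIntegral_congr_fun (measurableSet_primePowBall 0) h, setIntegral_const, Complex.real_smul, mul_one,
    measureReal_def]

/-- **The unramified value** `g(f) = μ(𝒪)` (a positive real number) for `ψ` of conductor exponent `0`, `a` a unit
and `q` odd (`‖2‖ = 1`): Weil's Gauss sum over `M'/L` has the single term `x = 0`.
[cite: Weil1964, Chap. II n° 27, p. 175] -/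
theorem weilGauss_of_unramified (hd : ψ.HasConductorExp 0) {a : F} (ha : normAbs F a = 1)
    (h2 : normAbs F (2 : F) = 1) : weilGauss ψ μ a = μ.real (primePowBall F 0) := by
  have ha' : normAbs F a = (residueFieldCard F : ℝ≥0)⁻¹ ^ (0 : ℤ) := by rw [zpow_zero, ha]
  have h2' : normAbs F (2 : F) = (residueFieldCard F : ℝ≥0)⁻¹ ^ (0 : ℤ) := by rw [zpow_zero, h2]
  rw [weilGauss_eq_gaussBall μ hd ha' h2' (n₀ := 0) (by norm_num), gaussBall_zero_of_unramified μ hd ha.le]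

end Evaluations

end Literature.NumberTheory.Weil1964
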